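import Mathlib
import HarnessLib
import Summits.HodgeConjecture.HodgeConjecture.Theses.EndoscopicMiddleDegree
import Literature.AlgebraicGeometry.HodgeTheory.ComplexGysin
import Literature.AlgebraicGeometry.HodgeTheory.HardLefschetzNFold

/-!
# Sketch — crux-ideate stmt-HodgeConjecture-14353 (SectorComplement), ideator 2, round 1

First lemmas of the two idea cards, stated over existing declarations (they must elaborate; the
first one is in fact proved, to certify that the descent step is pure logic once its geometric
inputs are supplied).

* Card `anti-ample-gysin-codim-three`: `GysinDivisorDescent` (+ proof), `FiveBallCodimThree`,
  `FiveBallCodimThreeFromSector` (the claimed sector-enlargement, hypotheses named).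
* Card `kuga-sato-leray-shell`: `KugaSatoTrivialPart` (+ proof: the λ = 0 Leray input is exactly
  the sector), the programme-level cruxes K1/K2 are informal.
-/

namespace Summit.HodgeConjecture.HodgeConjecture.Cruxes.SectorComplement.IdeatorTwo

open CategoryTheory
open Literature.AlgebraicGeometry.HodgeTheory Literature.AlgebraicGeometry.Motives
open Literature.AlgebraicGeometry.ShimuraVarieties
open Summit.HodgeConjecture.HodgeConjecture.Theses.EndoscopicMiddleDegree

/-- **Anti-ample (or ample) divisor descent one step above the middle** (card 1, first lemma).
`ι : Y⁵ ⟶ X⁶` a morphism of smooth projective varieties (intended: the closed embedding of a special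
divisor of a compact 6-ball quotient), `Λ` hard-Lefschetz data on `Y` for an ample class `h`, and the
SELF-INTERSECTION FORMULA in degree 4 in the form `ι^* ι_* y = r • (h ∪ y)` with `r ≠ 0` (for a special
divisor `N_{Y/X} = L_Y⁻¹` is anti-ample, `c₁(N) = -(1/N')·h`). If Gysin preserves rationality and Hodge
type (tree: `isOfHodgeType_complexGysin`, `ComplexGysinRational`), pull-back preserves algebraic
classes, and every rational `(3,3)`-class on `X` is algebraic (the sector's middle degree), then every
rational `(3,3)`-class on `Y` is algebraic. -/
def GysinDivisorDescent : Prop :=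
  ∀ (μ : OrientationFamily) ⦃Y X : SchemeOver ℂ⦄ (hY : IsSmoothProjective 5 Y)
    (hX : IsSmoothProjective 6 X) (ι : Y ⟶ X) (Λ : HardLefschetzNFold 5 Y) (r : ℚ), r ≠ 0 →
    (∀ y : complexBetti Y (2 * 2),
      complexBetti.map ι (2 * 3)
        (complexGysin μ hY hX ι (a := 2 * 2) (b := 2 * 3) (by norm_num) y) =
        (r : ℂ) • Λ.L 1 (2 * 2) (2 * 3) (by norm_num) y) →
    (∀ y : complexBetti Y (2 * 2), IsRationalClass y →
      IsRationalClass (complexGysin μ hY hX ι (a := 2 * 2) (b := 2 * 3) (by norm_num) y)) →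
    (∀ y : complexBetti Y (2 * 2), IsOfHodgeType 5 Y (2 * 2) 2 2 y →
      IsOfHodgeType 6 X (2 * 3) 3 3 (complexGysin μ hY hX ι (a := 2 * 2) (b := 2 * 3) (by norm_num) y)) →
    (∀ c : complexBetti X (2 * 3), IsRationalClass c → IsOfHodgeType 6 X (2 * 3) 3 3 c →
      c ∈ algebraicClasses X 3) →
    (∀ c : complexBetti X (2 * 3), c ∈ algebraicClasses X 3 →
      complexBetti.map ι (2 * 3) c ∈ algebraicClasses Y 3) →
    ∀ c : complexBetti Y (2 * 3), IsRationalClass c → IsOfHodgeType 5 Y (2 * 3) 3 3 c →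
      c ∈ algebraicClasses Y 3

/-- The descent step is pure logic + hard Lefschetz ONTO Hodge classes (`exists_hdg_preimage`). -/
theorem gysinDivisorDescent_holds : GysinDivisorDescent := by
  intro μ Y X hY hX ι Λ r hr hself hrat htype hHC hpull c hc hct
  obtain ⟨a, ha, hat, rfl⟩ :=
    Λ.exists_hdg_preimage (j := 1) (k := 2 * 2) (by norm_num) (2 * 3) (by norm_num) 2 2 c hc hct
  have h1 : complexGysin μ hY hX ι (a := 2 * 2) (b := 2 * 3) (by norm_num) a ∈ algebraicClasses X 3 :=
    hHC _ (hrat a ha) (htype a hat)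
  have h2 := hpull _ h1
  rw [hself a] at h2
  have hr' : (r : ℂ) ≠ 0 := by exact_mod_cast hr
  exact (Submodule.smul_mem_iff _ hr').1 h2

/-- **HC in codimension 3 on compact arithmetic 5-ball quotients** (card 1, the shell it adds to the
sector): every rational `(3,3)`-class on an `X` carrying a `UnitaryBallQuotientDatum 5 X` is algebraic.
Open today (degree 6 = 2·3 and 3 ∈ ]5/3, 10/3[ is excluded by BMM Cor. 2 at p = 5). -/
def FiveBallCodimThree : Prop :=
  ∀ (X : SchemeOver ℂ), Nonempty (UnitaryBallQuotientDatum 5 X) →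
    ∀ c : complexBetti X (2 * 3), IsRationalClass c → IsOfHodgeType 5 X (2 * 3) 3 3 c →
      c ∈ algebraicClasses X 3

/-- BMM Cor. 2 at (p, n) = (6, 2), written inline (the tree fact `bmm2016_*` is conditional in print):
rational `(2,2)`-classes on compact arithmetic 6-ball quotients are algebraic. -/
def BMMSixTwo : Prop :=
  ∀ (X : SchemeOver ℂ), Nonempty (UnitaryBallQuotientDatum 6 X) →
    ∀ a : complexBetti X (2 * 2), IsRationalClass a → IsOfHodgeType 6 X (2 * 2) 2 2 a →
      a ∈ algebraicClasses X 2

/-- **Special-divisor domination** (card 1, the geometric input, stated as a descent principle so that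
no new vocabulary is needed): HC in codimension 3 for every datum-5 ball quotient follows from HC in
codimension 3 for every smooth projective 5-fold `Y` that maps to a datum-6 ball quotient `X⁶` by a
morphism `ι` satisfying the self-intersection identity `ι^*ι_* = r • L` (`r ≠ 0`) in degree 4.
(Content: `X⁵` is, up to a finite étale cover — along which rational Hodge classes and algebraicity
descend by `π_*π^* = deg` — a smooth embedded special divisor `Y = D.specialSubvariety (E·e)`,
`(e,e) = 1`, of the datum-6 quotient attached to `H ⊕ ⟨1⟩`, with `N_{Y/X⁶} = L_Y⁻¹`;
Millson–Raghunathan / Bergeron for embeddedness at deep level.) -/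
def SpecialDivisorDomination : Prop :=
  (∀ (μ : OrientationFamily) ⦃Y X : SchemeOver ℂ⦄ (hY : IsSmoothProjective 5 Y)
      (hX : IsSmoothProjective 6 X) (ι : Y ⟶ X) (Λ : HardLefschetzNFold 5 Y) (r : ℚ), r ≠ 0 →
      Nonempty (UnitaryBallQuotientDatum 6 X) →
      (∀ y : complexBetti Y (2 * 2),
        complexBetti.map ι (2 * 3)
          (complexGysin μ hY hX ι (a := 2 * 2) (b := 2 * 3) (by norm_num) y) =
          (r : ℂ) • Λ.L 1 (2 * 2) (2 * 3) (by norm_num) y) →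
      ∀ c : complexBetti Y (2 * 3), IsRationalClass c → IsOfHodgeType 5 Y (2 * 3) 3 3 c →
        c ∈ algebraicClasses Y 3) →
    FiveBallCodimThree

/-- **Card 1, the claimed enlargement of the sector** (all hypotheses named; the two Gysin
compatibilities and the pull-back compatibility are tree-level facts quoted as binders):
`MiddleDegreeStep ∧ BMM(6,2) ∧ SpecialDivisorDomination ⟹ FiveBallCodimThree`. -/
def FiveBallCodimThreeFromSector : Prop :=
  MiddleDegreeStep → BMMSixTwo → SpecialDivisorDomination →
    (∀ (μ : OrientationFamily) ⦃Y X : SchemeOver ℂ⦄ (hY : IsSmoothProjective 5 Y)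
        (hX : IsSmoothProjective 6 X) (ι : Y ⟶ X) (y : complexBetti Y (2 * 2)),
        (IsRationalClass y →
          IsRationalClass (complexGysin μ hY hX ι (a := 2 * 2) (b := 2 * 3) (by norm_num) y)) ∧
        (IsOfHodgeType 5 Y (2 * 2) 2 2 y →
          IsOfHodgeType 6 X (2 * 3) 3 3 (complexGysin μ hY hX ι (a := 2 * 2) (b := 2 * 3) (by norm_num) y))) →
    (∀ ⦃Y X : SchemeOver ℂ⦄ (ι : Y ⟶ X), IsSmoothProjective 5 Y → IsSmoothProjective 6 X →
        ∀ c : complexBetti X (2 * 3), c ∈ algebraicClasses X 3 →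
          complexBetti.map ι (2 * 3) c ∈ algebraicClasses Y 3) →
    FiveBallCodimThree

/-- The enlargement is pure logic from `gysinDivisorDescent_holds` (kernel-checked composition). -/
theorem fiveBallCodimThreeFromSector_holds : FiveBallCodimThreeFromSector := by
  intro hstep hbmm hdom hgys hpull
  refine hdom fun μ Y X hY hX ι Λ r hr hD hself ↦ ?_
  have hHC6 : ∀ c : complexBetti X (2 * 3), IsRationalClass c → IsOfHodgeType 6 X (2 * 3) 3 3 c →
      c ∈ algebraicClasses X 3 :=
    hstep 2 X (by norm_num) le_rfl hD (hbmm X hD)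
  exact gysinDivisorDescent_holds μ hY hX ι Λ r hr hself (fun y hy ↦ (hgys μ hY hX ι y).1 hy)
    (fun y hy ↦ (hgys μ hY hX ι y).2 hy) hHC6 (hpull ι hY hX)

/-- **Card 2, first lemma (the λ = 0 Leray input is the sector)**: for any smooth projective `A`
mapping to a sector variety `X` (intended: a fibre power of the universal abelian scheme, or any
family pulled back along a period map), the classes `π^* c`, `c` a rational middle-degree Hodge class
of `X`, are algebraic on `A` — granted `MiddleDegreeStep`, its lower-degree input, and pull-back
compatibility. The remaining Leray pieces (λ ≠ 0: theta with coefficients; Noether–Lefschetz / CM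
fibres) are the card's informal cruxes. -/
def KugaSatoTrivialPart : Prop :=
  MiddleDegreeStep →
    ∀ (m : ℕ) (X : SchemeOver ℂ), 1 ≤ m → m ≤ 2 →
      Nonempty (UnitaryBallQuotientDatum (2 * (m + 1)) X) →
      (∀ a : complexBetti X (2 * m), IsRationalClass a →
        IsOfHodgeType (2 * (m + 1)) X (2 * m) m m a → a ∈ algebraicClasses X m) →
      ∀ (k : ℕ) (A : SchemeOver ℂ) (π : A ⟶ X), IsSmoothProjective k A →
        (∀ (p : ℕ) (c : complexBetti X (2 * p)), c ∈ algebraicClasses X p →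
          complexBetti.map π (2 * p) c ∈ algebraicClasses A p) →
        ∀ c : complexBetti X (2 * (m + 1)), IsRationalClass c →
          IsOfHodgeType (2 * (m + 1)) X (2 * (m + 1)) (m + 1) (m + 1) c →
          complexBetti.map π (2 * (m + 1)) c ∈ algebraicClasses A (m + 1)

theorem kugaSatoTrivialPart_holds : KugaSatoTrivialPart :=
  fun hstep m X h1 h2 hD hlow _k A π _hA hpull c hc hct ↦
    hpull (m + 1) c (hstep m X h1 h2 hD hlow c hc hct)

end Summit.HodgeConjecture.HodgeConjecture.Cruxes.SectorComplement.IdeatorTwo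

/-! ## Card 1, main lever: the DESCENDING STAIRCASE (cup with the Hodge class, realised by sector
ball quotients one dimension down, inverts hard Lefschetz algebraically above the middle) -/

namespace Summit.HodgeConjecture.HodgeConjecture.Cruxes.SectorComplement.IdeatorTwo

open CategoryTheory
open Literature.AlgebraicTopology.SingularHomology
open Literature.AlgebraicGeometry.HodgeTheory Literature.AlgebraicGeometry.Motives
open Literature.AlgebraicGeometry.ShimuraVarieties
open Summit.HodgeConjecture.HodgeConjecture.Theses.EndoscopicMiddleDegree

/-- **Staircase step, abstract form** (card 1, FIRST LEMMA — proved below): `S` smooth projective of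
dimension `p+1`, `κ ∈ H²(S)` a class written as a `ℚ`-combination of Gysin images `ν_{i*} 1` of maps
`ν_i : Z_i ⟶ S` from smooth projective `p`-folds (intended: `κ = c₁(L)` ample, `Z_i` = the sector ball
quotients normalising the special divisors, `κ ∈ span [Z_i]` by Kudla–Millson modularity). If the
pulled-back classes `ν_i^* c` of rational Hodge `(k,k)`-classes `c` are algebraic on the `Z_i` (HC on
the smaller ball quotients in degree `2k`) and `ν_{i*}` preserves algebraic classes, then `c ∪ κ` is
algebraic for every rational Hodge `(k,k)`-class `c` on `S` (projection formula
`ν_*(ν^* c ∪ 1) = c ∪ ν_* 1`). -/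
def StaircaseStep : Prop :=
  ∀ (μ : OrientationFamily), μ.HasPoincareDuality →
    ∀ ⦃p k : ℕ⦄ ⦃S : SchemeOver ℂ⦄ (hS : IsSmoothProjective (p + 1) S) (κ : complexBetti S 2)
      (ι : Type) [Fintype ι] (Z : ι → SchemeOver ℂ) (hZ : ∀ i, IsSmoothProjective p (Z i))
      (ν : ∀ i, Z i ⟶ S) (q : ι → ℚ),
      κ = ∑ i, (q i : ℂ) • complexGysin μ (hZ i) hS (ν i) (a := 0) (b := 2) (by omega)
            (singularCohomology.one ℂ (ComplexPoints (Z i))) →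
      (∀ i (c : complexBetti S (2 * k)), IsRationalClass c → IsOfHodgeType (p + 1) S (2 * k) k k c →
          complexBetti.map (ν i) (2 * k) c ∈ algebraicClasses (Z i) k) →
      (∀ i (z : complexBetti (Z i) (2 * k)), z ∈ algebraicClasses (Z i) k →
          complexGysin μ (hZ i) hS (ν i) (a := 2 * k) (b := 2 * (k + 1)) (by omega) z ∈
            algebraicClasses S (k + 1)) →
      ∀ c : complexBetti S (2 * k), IsRationalClass c → IsOfHodgeType (p + 1) S (2 * k) k k c →
        cupProduct (show 2 * k + 2 = 2 * (k + 1) by omega) c κ ∈ algebraicClasses S (k + 1)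

theorem staircaseStep_holds : StaircaseStep := by
  intro μ hμ p k S hS κ ι _ Z hZ ν q hκ hHC hpush c hc hct
  subst hκ
  rw [map_sum]
  refine Submodule.sum_mem _ fun i _ ↦ ?_
  rw [map_smul]
  refine Submodule.smul_mem _ _ ?_
  have key := complexGysin_cup hμ (hZ i) hS (ν i) (p := 2 * k) (q := 0) (a := 2 * k)
      (b := 2 * (k + 1)) (q' := 2) (Nat.add_zero _) (by omega) (by omega) (by omega) c
      (singularCohomology.one ℂ (ComplexPoints (Z i)))
  rw [cupProduct_one] at key
  rw [← key]
  exact hpush i _ (hHC i c hc hct)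

/-- HC in codimension 4 on compact arithmetic 7-ball quotients (open: 4 ∈ ]7/3, 14/3[). -/
def SevenBallCodimFour : Prop :=
  ∀ (X : SchemeOver ℂ), Nonempty (UnitaryBallQuotientDatum 7 X) →
    ∀ c : complexBetti X (2 * 4), IsRationalClass c → IsOfHodgeType 7 X (2 * 4) 4 4 c →
      c ∈ algebraicClasses X 4

/-- HC in codimension 5 on compact arithmetic 8-ball quotients (open: 5 ∈ ]8/3, 16/3[). -/
def EightBallCodimFive : Prop :=
  ∀ (X : SchemeOver ℂ), Nonempty (UnitaryBallQuotientDatum 8 X) →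
    ∀ c : complexBetti X (2 * 5), IsRationalClass c → IsOfHodgeType 8 X (2 * 5) 5 5 c →
      c ∈ algebraicClasses X 5

/-- Lefschetz (1,1) on datum-4 varieties (the input of `MiddleDegreeStep` at `m = 1`; a theorem). -/
def LefschetzOneOneOnFourBalls : Prop :=
  ∀ (X : SchemeOver ℂ), Nonempty (UnitaryBallQuotientDatum 4 X) →
    ∀ a : complexBetti X (2 * 1), IsRationalClass a → IsOfHodgeType 4 X (2 * 1) 1 1 a →
      a ∈ algebraicClasses X 1

/-- **KM₀ (Kudla–Millson): a polarization of a compact arithmetic ball quotient lies in the span of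
its special divisors.** For `D : UnitaryBallQuotientDatum (p+1) S` there is hard-Lefschetz data `Λ`
(for the polarization `L^{⊗N}`, `K_S = (p+2)·c₁(L)`) whose hyperplane class is a finite sum of
classes supported on special divisors `D.specialSubvariety W`, `W` a totally positive LINE. (In print:
the class-valued theta series `[θ₁(g',φ)] = Σ_{β ≥ 0} [β,φ] W_β(g')` is a holomorphic modular form of
weight `p+2 > 0` on `U(1,1)` [BMM arXiv:1306.1515 p.37 Prop. 68 = Kudla–Millson, Publ. IHÉS 71 (1990), main
theorem], whose `β = 0` coefficient is `[0,φ] = L([Z(0,φ)]) = φ(0)·[Ω]`, `Ω` the Chern form of `K_S`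
[ibid. p.36]; a linear form killing all `[Z(β,φ)]`, `β > 0`, but not `c₁(K_S)` would produce a non-zero
CONSTANT holomorphic form of positive weight.) -/
def KMZero : Prop :=
  ∀ (p : ℕ) (S : SchemeOver ℂ) (D : UnitaryBallQuotientDatum (p + 1) S),
    ∃ (Λ : HardLefschetzNFold (p + 1) S) (n : ℕ) (W : Fin n → Submodule D.E (Fin (p + 1 + 1) → D.E))
      (d : Fin n → complexBetti S 2),
      (∀ i, IsTotallyPositive (conjRingHom D.E) D.H (W i) ∧ Module.finrank D.E (W i) = 1 ∧
        d i ∈ classesSupportedOn S (D.specialSubvariety (W i)) 2) ∧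
      Λ.hyperplaneClass = ∑ i, d i

/-- **Special-divisor bridge** (plumbing, to be proved from `StaircaseStep`): a class `d` supported on
a special divisor of a datum-`(p+1)` variety is a combination of Gysin images `ν_* 1` of datum-`p`
ball quotients `ν : Z ⟶ S` (normalisations of the components: images of `𝔹ᵖ ⊂ 𝔹ᵖ⁺¹`; Fulton §19.1 for
"classes supported on a divisor = span of component classes"), `ν^*` preserves rationality and Hodge
type, `ν_*` preserves algebraic classes; HENCE HC in degree `2k` on all datum-`p` varieties makes
`c ∪ d` algebraic for every rational Hodge `(k,k)`-class `c` on `S`. -/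
def SpecialDivisorBridge : Prop :=
  ∀ (p k : ℕ) (S : SchemeOver ℂ) (D : UnitaryBallQuotientDatum (p + 1) S),
    (∀ (Z : SchemeOver ℂ), Nonempty (UnitaryBallQuotientDatum p Z) →
        ∀ z : complexBetti Z (2 * k), IsRationalClass z → IsOfHodgeType p Z (2 * k) k k z →
          z ∈ algebraicClasses Z k) →
    ∀ (W : Submodule D.E (Fin (p + 1 + 1) → D.E)), IsTotallyPositive (conjRingHom D.E) D.H W →
      Module.finrank D.E W = 1 →
      ∀ d ∈ classesSupportedOn S (D.specialSubvariety W) 2,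
        ∀ c : complexBetti S (2 * k), IsRationalClass c → IsOfHodgeType (p + 1) S (2 * k) k k c →
          cupProduct (show 2 * k + 2 = 2 * (k + 1) by omega) c d ∈ algebraicClasses S (k + 1)

/-- **Card 1, the three new cells of the frame** claimed from the sector:
`MiddleDegreeStep ∧ BMM(6,2) ∧ Lefschetz(1,1) ∧ KM₀ ∧ bridge ∧ graded-commutativity ⟹`
HC for compact arithmetic ball quotients of dimension 5 in codimension 3 (from `m = 1`), of dimension
7 in codimension 4 and of dimension 8 in codimension 5 (from `m = 2`, chained). -/
def StaircaseCells : Prop :=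
  MiddleDegreeStep → BMMSixTwo → LefschetzOneOneOnFourBalls → KMZero → SpecialDivisorBridge →
    (∀ S : SchemeOver ℂ, cupProduct_gradedComm ℂ (ComplexPoints S)) →
    FiveBallCodimThree ∧ SevenBallCodimFour ∧ EightBallCodimFive

/-- `c ∪ h ∈ Alg` for rational Hodge `c` of degree `2k` on a datum-`(p+1)` variety, from HC in degree
`2k` on datum-`p` varieties (KM₀ decomposition + bridge). -/
theorem cup_hyperplane_mem (hbridge : SpecialDivisorBridge) {p k : ℕ} {S : SchemeOver ℂ}
    (D : UnitaryBallQuotientDatum (p + 1) S)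
    (hA : ∀ (Z : SchemeOver ℂ), Nonempty (UnitaryBallQuotientDatum p Z) →
        ∀ z : complexBetti Z (2 * k), IsRationalClass z → IsOfHodgeType p Z (2 * k) k k z →
          z ∈ algebraicClasses Z k)
    (Λ : HardLefschetzNFold (p + 1) S) {n : ℕ} (W : Fin n → Submodule D.E (Fin (p + 1 + 1) → D.E))
    (d : Fin n → complexBetti S 2)
    (hd : ∀ i, IsTotallyPositive (conjRingHom D.E) D.H (W i) ∧ Module.finrank D.E (W i) = 1 ∧
        d i ∈ classesSupportedOn S (D.specialSubvariety (W i)) 2)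
    (hsum : Λ.hyperplaneClass = ∑ i, d i)
    (c : complexBetti S (2 * k)) (hc : IsRationalClass c) (hct : IsOfHodgeType (p + 1) S (2 * k) k k c) :
    cupProduct (show 2 * k + 2 = 2 * (k + 1) by omega) c Λ.hyperplaneClass ∈ algebraicClasses S (k + 1) := by
  rw [hsum, map_sum]
  exact Submodule.sum_mem _ fun i _ ↦
    hbridge p k S D hA (W i) (hd i).1 (hd i).2.1 (d i) (hd i).2.2 c hc hct

/-- `L c = h ∪ c = c ∪ h` (even degrees). -/
theorem L_one_eq_cup {p k : ℕ} {S : SchemeOver ℂ} (hcomm : cupProduct_gradedComm ℂ (ComplexPoints S))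
    (Λ : HardLefschetzNFold (p + 1) S) (c : complexBetti S (2 * k)) :
    Λ.L 1 (2 * k) (2 * (k + 1)) (by omega) c =
      cupProduct (show 2 * k + 2 = 2 * (k + 1) by omega) c Λ.hyperplaneClass := by
  rw [HardLefschetzNFold.L, lefschetzPowTo_succ_apply _ 0 (2 * k) (2 * k) (2 * (k + 1)) rfl (by omega)
    (by omega), lefschetzPowTo_zero_apply, Literature.Geometry.Kaehler.lefschetzOperator_apply,
    hcomm (show 2 + 2 * k = 2 * (k + 1) by omega) (show 2 * k + 2 = 2 * (k + 1) by omega)]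
  rw [pow_mul]
  simp

theorem staircaseCells_holds : StaircaseCells := by
  intro hstep hbmm hL11 hKM hbridge hcomm
  -- the sector: A(4,4) and A(6,6)
  have A44 : ∀ (Z : SchemeOver ℂ), Nonempty (UnitaryBallQuotientDatum 4 Z) →
      ∀ z : complexBetti Z (2 * 2), IsRationalClass z → IsOfHodgeType 4 Z (2 * 2) 2 2 z →
        z ∈ algebraicClasses Z 2 :=
    fun Z hZ z hz hzt ↦ hstep 1 Z le_rfl (by norm_num) hZ (hL11 Z hZ) z hz hzt
  have A66 : ∀ (Z : SchemeOver ℂ), Nonempty (UnitaryBallQuotientDatum 6 Z) →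
      ∀ z : complexBetti Z (2 * 3), IsRationalClass z → IsOfHodgeType 6 Z (2 * 3) 3 3 z →
        z ∈ algebraicClasses Z 3 :=
    fun Z hZ z hz hzt ↦ hstep 2 Z (by norm_num) le_rfl hZ (hbmm Z hZ) z hz hzt
  -- cell (5, codim 3)
  have A56 : FiveBallCodimThree := by
    intro S hD c hc hct
    obtain ⟨D⟩ := hD
    obtain ⟨Λ, n, W, d, hd, hsum⟩ := hKM 4 S D
    obtain ⟨β, hβ, hβt, rfl⟩ :=
      Λ.exists_hdg_preimage (j := 1) (k := 2 * 2) (by norm_num) (2 * 3) (by norm_num) 2 2 c hc hct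
    rw [L_one_eq_cup (hcomm S) Λ β]
    exact cup_hyperplane_mem hbridge D A44 Λ W d hd hsum β hβ hβt
  -- cell (7, codim 4)
  have A78 : SevenBallCodimFour := by
    intro S hD c hc hct
    obtain ⟨D⟩ := hD
    obtain ⟨Λ, n, W, d, hd, hsum⟩ := hKM 6 S D
    obtain ⟨β, hβ, hβt, rfl⟩ :=
      Λ.exists_hdg_preimage (j := 1) (k := 2 * 3) (by norm_num) (2 * 4) (by norm_num) 3 3 c hc hct
    rw [L_one_eq_cup (hcomm S) Λ β]
    exact cup_hyperplane_mem hbridge D A66 Λ W d hd hsum β hβ hβt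
  -- cell (8, codim 5): c = L²β₀ = L(Lβ₀)
  have A810 : EightBallCodimFive := by
    intro S hD c hc hct
    obtain ⟨D⟩ := hD
    obtain ⟨Λ, n, W, d, hd, hsum⟩ := hKM 7 S D
    obtain ⟨β₀, hβ₀, hβ₀t, rfl⟩ :=
      Λ.exists_hdg_preimage (j := 2) (k := 2 * 3) (by norm_num) (2 * 5) (by norm_num) 3 3 c hc hct
    rw [HardLefschetzNFold.L, lefschetzPowTo_succ_apply _ 1 (2 * 3) (2 * 4) (2 * 5) (by norm_num)
      (by norm_num) (by norm_num), Literature.Geometry.Kaehler.lefschetzOperator_apply,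
      hcomm S (show 2 + 2 * 4 = 2 * 5 by norm_num) (show 2 * 4 + 2 = 2 * (4 + 1) by norm_num),
      pow_mul]
    simp only [even_two, Even.neg_pow, one_pow, one_smul]
    refine cup_hyperplane_mem hbridge D A78 Λ W d hd hsum _ ?_ ?_
    · exact Λ.isRationalClass_L 1 (2 * 3) (2 * 4) (by norm_num) hβ₀
    · exact Λ.isOfHodgeType_L 1 (2 * 3) (2 * 4) (by norm_num) 3 3 hβ₀t
  exact ⟨A56, A78, A810⟩

end Summit.HodgeConjecture.HodgeConjecture.Cruxes.SectorComplement.IdeatorTwo
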